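import Literature.RingTheory.FormalGroups.DworkFrobeniusLift
import Literature.NumberTheory.EllipticCurves.PadicSeriesEvaluation
import HarnessLib

/-!
# Integrality from a functional equation along an INVERTIBLE substitution
# (Perrin-Riou 1984, Ch. III §1.2, the mechanism of Lemme 2 — proofs only)

Topic `RingTheory/FormalGroups` (proofs only; no definitions, no named facts). Companion of
`DworkFrobeniusLift.lean` (Dwork's lemma: integrality of `s` from `s(φ) = sᵖ·u` along a FROBENIUS
LIFT `φ ≡ Xᵖ`). Here the substitution is an AUTOMORPHISM `T = wX + ⋯ ∈ XA⟦X⟧`, `w ∈ Aˣ`, of the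
formal disc and the exponent `N` is a NON-unit: this is the integrality argument of
B. Perrin-Riou, *Arithmétique des courbes elliptiques et théorie d'Iwasawa*, Mém. SMF 17 (1984),
Ch. III §1.2, proof of Lemme 2 (p. 54–55), by which the `p`-adic CM sigma function
`σ_v(L_v(t))` of a CM elliptic curve is shown to lie in `t(1 + tR⟦t⟧)`: with `h = σ_v(t)/t` one has
`h([π*]t) = h(t)ᵖ·u(t)`, `u ∈ 1 + tR⟦t⟧`, `[π*](t) = π*t + ⋯` with `π*` a UNIT of `R` (the conjugate
of the uniformiser); writing `h = ∏(1 - aₙtⁿ)` and looking at the first non-integral `a_m`, «ce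
quotient commence par `1 - (π*ᵐ - p)a_m tᵐ + ⋯`. Comme `π*` est une unité dans `R_v`, `a_m`
appartient à `R_v`». We run the same comparison of the coefficient of `tᵐ` directly on the
coefficients of `h` (no product expansion is needed): if the coefficients of `h` below degree `m`
are integral, `h = h_{<m} + tᵐr`, then

  `[tᵐ] h(T) = [tᵐ] h_{<m}(T) + wᵐ·h_m`,   `[tᵐ] (hᴺ·u) = [tᵐ](h_{<m}ᴺ·u) + N·h_m`

(`u(0) = 1`), so `(wᵐ - N)·h_m` is integral, and `wᵐ - N` is a unit.

* `isPadicInt_of_subst_eq_pow_mul` — over `ℚ_p` (integrality = `IsPadicInt`, all coefficients of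
  norm `≤ 1`, `Literature/NumberTheory/EllipticCurves/PadicSeriesEvaluation`): if `h ∈ 1 + Xℚ_p⟦X⟧`,
  `T ∈ Xℤ_p⟦X⟧`, `u ∈ ℤ_p⟦X⟧`, `‖([X¹]T)ᵐ - N‖ = 1` for all `m ≥ 1`, and `h(T) = hᴺ·u`, then
  `h ∈ ℤ_p⟦X⟧`. (For `p = 2`, `N = 2`, `[X¹]T` a `2`-adic unit the unit condition is automatic:
  `isPadicInt_of_subst_eq_sq_mul_two`.)

## Sources

* B. Perrin-Riou, Mém. Soc. Math. France (N.S.) 17 (1984), Ch. III §1.2, Lemme 2 and its proof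
  (pp. 54–55). [Perrinriou1984]
* N. Koblitz, GTM 58 (1984), Ch. IV §2, Lemma 3 (the shape of the coefficient induction).
  [Koblitz1984]

## Design notes

Pure proof file about Mathlib's `PowerSeries.subst`; the splitting `h = h_{<m} + Xᵐ·r` uses
`PowerSeries.trunc`. Integrality is the tree's `IsPadicInt` so that the consumer
(`Literature/NumberTheory/EllipticCurves/PadicSigmaSqCMIntegralityProofs`) can feed the result into
`WeierstrassCurve.IsMazurTateSigmaSqPair.norm_coeff_le`.
-/

noncomputable section

open PowerSeries Literature.NumberTheory.EllipticCurves

namespace Literature.RingTheory.FormalGroups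

variable {p : ℕ} [Fact p.Prime]

/-- Splitting a series at degree `m`: `h = h_{<m} + Xᵐ·r` with `h_{<m} = trunc m h` and
`r = Σ h_{m+i} Xⁱ` (so `r(0) = h_m`). [folklore] -/
private theorem eq_trunc_add_X_pow_mul (h : ℚ_[p]⟦X⟧) (m : ℕ) :
    h = (trunc m h : ℚ_[p]⟦X⟧) + X ^ m * PowerSeries.mk fun i => coeff (m + i) h := by
  ext n
  rw [map_add, Polynomial.coeff_coe, coeff_trunc, coeff_X_pow_mul']
  split_ifs with h1 h2 h2
  · omega
  · rw [add_zero]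
  · rw [coeff_mk, zero_add, Nat.add_sub_cancel' h2]
  · omega

/-- The truncation of a series with integral coefficients below degree `m` is integral. [folklore] -/
private theorem isPadicInt_trunc {h : ℚ_[p]⟦X⟧} {m : ℕ} (hm : ∀ n < m, ‖coeff n h‖ ≤ 1) :
    IsPadicInt (trunc m h : ℚ_[p]⟦X⟧) := by
  rw [isPadicInt_iff_coeff]
  intro n
  rw [Polynomial.coeff_coe, coeff_trunc]
  split_ifs with hn
  · exact hm n hn
  · rw [norm_zero]; exact zero_le_one

/-- **Perrin-Riou's integrality argument (Mém. SMF 17, Ch. III §1.2, proof of Lemme 2).** Let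
`h ∈ 1 + Xℚ_p⟦X⟧`, `T ∈ Xℤ_p⟦X⟧` with linear coefficient `w`, `u ∈ ℤ_p⟦X⟧`, `N ∈ ℕ`, and suppose
`‖wᵐ - N‖ = 1` for every `m ≥ 1` (e.g. `w ∈ ℤ_pˣ` and `p ∣ N`). If `h(T) = hᴺ·u` then
`h ∈ ℤ_p⟦X⟧`. («Mais ce quotient commence par `1 - (π*ᵐ - p)a_m tᵐ + ⋯`. Comme `π*` est une unité
dans `R_v`, `a_m` appartient à `R_v`, ce qui finit la démonstration du lemme 2.»)
[cite: Perrinriou1984, Ch. III §1.2 Lemme 2] -/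
theorem isPadicInt_of_subst_eq_pow_mul {h T u : ℚ_[p]⟦X⟧} {N : ℕ} (hh0 : constantCoeff h = 1)
    (hT0 : constantCoeff T = 0) (hT : IsPadicInt T) (hu : IsPadicInt u)
    (hunit : ∀ m : ℕ, 1 ≤ m → ‖coeff 1 T ^ m - N‖ = 1) (hfe : h.subst T = h ^ N * u) :
    IsPadicInt h := by
  have hsT : HasSubst T := HasSubst.of_constantCoeff_zero' hT0
  -- `u(0) = 1`
  have hu0 : constantCoeff u = 1 := by
    have e := congrArg constantCoeff hfe
    rwa [constantCoeff_subst_of_constantCoeff_eq_zero hT0, map_mul, map_pow, hh0, one_pow, one_mul,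
      eq_comm] at e
  rw [isPadicInt_iff_coeff]
  intro n
  induction n using Nat.strong_induction_on with
  | _ m ih =>
    rcases Nat.eq_zero_or_pos m with rfl | hm
    · rw [coeff_zero_eq_constantCoeff, hh0, norm_one]
    -- split `h = h_{<m} + Xᵐ r`
    set hm_ : ℚ_[p]⟦X⟧ := (trunc m h : ℚ_[p]⟦X⟧) with hhm_
    set r : ℚ_[p]⟦X⟧ := PowerSeries.mk fun i => coeff (m + i) h with hr
    have hsplit : h = hm_ + X ^ m * r := eq_trunc_add_X_pow_mul h m
    have hr0 : constantCoeff r = coeff m h := by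
      rw [hr, ← coeff_zero_eq_constantCoeff_apply, coeff_mk, add_zero]
    have hm_int : IsPadicInt hm_ := isPadicInt_trunc ih
    have hm_0 : constantCoeff hm_ = 1 := by
      rw [hhm_, ← coeff_zero_eq_constantCoeff_apply, Polynomial.coeff_coe, coeff_trunc, if_pos hm,
        coeff_zero_eq_constantCoeff, hh0]
    -- the two sides at the coefficient of `Xᵐ`
    -- (a) `[Xᵐ] h(T) = [Xᵐ] h_{<m}(T) + wᵐ h_m`
    have ha : coeff m (h.subst T) = coeff m (hm_.subst T) + coeff 1 T ^ m * coeff m h := by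
      rw [hsplit, subst_add hsT, map_add, subst_mul hsT, subst_pow hsT, subst_X hsT,
        coeff_pow_mul_of_constantCoeff_eq_zero hT0, constantCoeff_subst_of_constantCoeff_eq_zero hT0, hr0,
        ← hsplit]
    -- (b) `[Xᵐ] (hᴺ u) = [Xᵐ](h_{<m}ᴺ u) + N h_m`
    have hb : coeff m (h ^ N * u) = coeff m (hm_ ^ N * u) + N * coeff m h := by
      have hgeom : h ^ N - hm_ ^ N =
          (∑ i ∈ Finset.range N, h ^ i * hm_ ^ (N - 1 - i)) * (X ^ m * r) := by
        rw [← geom_sum₂_mul, hsplit, add_sub_cancel_left]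
      have hS0 : constantCoeff (∑ i ∈ Finset.range N, h ^ i * hm_ ^ (N - 1 - i)) = N := by
        rw [map_sum]
        simp only [map_mul, map_pow, hh0, hm_0, one_pow, mul_one, Finset.sum_const, Finset.card_range,
          nsmul_eq_mul]
      have e : h ^ N * u = hm_ ^ N * u +
          X ^ m * ((∑ i ∈ Finset.range N, h ^ i * hm_ ^ (N - 1 - i)) * r * u) := by
        linear_combination u * hgeom
      have hc : constantCoeff ((∑ i ∈ Finset.range N, h ^ i * hm_ ^ (N - 1 - i)) * r * u) =
          N * coeff m h := by
        rw [RingHom.map_mul, RingHom.map_mul, hS0, hr0, hu0, mul_one]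
      rw [e, map_add, coeff_X_pow_mul', if_pos le_rfl, Nat.sub_self, coeff_zero_eq_constantCoeff_apply, hc]
    -- hence `(wᵐ - N) h_m = [Xᵐ](h_{<m}ᴺ u) - [Xᵐ] h_{<m}(T)` is integral
    have hkey : (coeff 1 T ^ m - N) * coeff m h = coeff m (hm_ ^ N * u) - coeff m (hm_.subst T) := by
      have e := congrArg (coeff m) hfe
      rw [ha, hb] at e
      linear_combination e
    have hint : ‖coeff m (hm_ ^ N * u) - coeff m (hm_.subst T)‖ ≤ 1 := by
      have h1 : IsPadicInt (hm_ ^ N * u) := (hm_int.pow N).mul hu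
      have h2 : IsPadicInt (hm_.subst T) := hm_int.powerSeries_subst hT hsT
      rw [isPadicInt_iff_coeff] at h1 h2
      rw [sub_eq_add_neg]
      exact (Padic.nonarchimedean _ _).trans (max_le (h1 m) ((norm_neg _).trans_le (h2 m)))
    have e := congrArg (‖·‖) hkey
    simp only [norm_mul, hunit m hm, one_mul] at e
    rw [e]; exact hint

/-- **The case `p = 2`, `N = 2`** (Perrin-Riou's Lemme 2 «everything squared», as needed for the
SQUARED sigma function at `p = 2`): if `h ∈ 1 + Xℚ₂⟦X⟧`, `T ∈ Xℤ₂⟦X⟧` with `[X¹]T` a `2`-adic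
unit, `u ∈ ℤ₂⟦X⟧` and `h(T) = h²·u`, then `h ∈ ℤ₂⟦X⟧` (`‖wᵐ - 2‖ = 1` since `‖wᵐ‖ = 1 > ‖2‖`).
[cite: Perrinriou1984, Ch. III §1.2 Lemme 2] -/
theorem isPadicInt_of_subst_eq_sq_mul_two {h T u : ℚ_[2]⟦X⟧} (hh0 : constantCoeff h = 1)
    (hT0 : constantCoeff T = 0) (hT : IsPadicInt T) (hw : ‖coeff 1 T‖ = 1) (hu : IsPadicInt u)
    (hfe : h.subst T = h ^ 2 * u) : IsPadicInt h := by
  refine isPadicInt_of_subst_eq_pow_mul (N := 2) hh0 hT0 hT hu (fun m _ => ?_) hfe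
  have h2 : ‖(2 : ℚ_[2])‖ < 1 := by exact_mod_cast Padic.norm_p_lt_one (p := 2)
  have hwm : ‖coeff 1 T ^ m‖ = 1 := by rw [norm_pow, hw, one_pow]
  have hne : ‖coeff 1 T ^ m‖ ≠ ‖(-(2 : ℚ_[2]))‖ := by rw [hwm, norm_neg]; exact h2.ne'
  rw [Nat.cast_ofNat, sub_eq_add_neg, Padic.add_eq_max_of_ne hne, hwm, norm_neg,
    max_eq_left h2.le]

end Literature.RingTheory.FormalGroups
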